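import Summits.KontsevichZagierPeriods.KontsevichZagierPeriods.Theorems.RootDecompQuadraticDescentPair18HomotopyP19

/-! # `RootDecompQuadraticDescentPair18HomotopyP20` — part 20/31 of the mechanical ≤400-line split of `Pair18Homotopy_v14_noguard.lean` (sha256 72e9c8442b4af820…)
Source: decomp-kz lens-6 g9 `Pair18Homotopy.lean` v14 (HOME/decomp-kz-lens-6/g9/, sha256 3dda3232…; critic g4-48/g4-53/g4-56/g5 CLEARED; census pair #18 of crux stmt-KontsevichZagierPeriods-28994: homotopy cells, duplications, inversions, Euler–Landen, arc/angle regions; terminal `pair18_g8strips_of_grid : hEuler → hGrid → hAng4 → (g8 form of #18)`); `#guard_msgs … #print axioms` pins removed for landing.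
Split by census-1 g9 `gen/splitlean.py`: scopes re-opened with their `open`/`variable`/`set_option` context; mathematics and declaration order unchanged. -/

set_option linter.unusedSimpArgs false
noncomputable section
open _root_.Set MvPolynomial
namespace Summit.KontsevichZagierPeriods.RootDecompQuadraticDescent.Pair18Homotopy
open Literature.NumberTheory.Transcendental
open Literature.NumberTheory.Transcendental.KZ (RFun cube)
open Summit.KontsevichZagierPeriods.RootDecompQuadraticDescent.DarkPairs (rel_reflect_rep rel_double)

section Pencil1
open Literature.ModelTheory.ExponentialFields (IsSemialgebraic isSemialgebraic_setOf_eval_le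
  isSemialgebraic_setOf_eval_pos)

open _root_.Set MvPolynomial in
open Literature.NumberTheory.Transcendental in
open Literature.NumberTheory.Transcendental.KZ (RFun cube) in
open Summit.KontsevichZagierPeriods.RootDecompQuadraticDescent.DarkPairs (rel_reflect_rep rel_double) in
open Literature.ModelTheory.ExponentialFields (IsSemialgebraic isSemialgebraic_setOf_eval_le isSemialgebraic_setOf_eval_pos) in
/-- Auxiliary step `isSemialgebraic_pos1`: is Semialgebraic pos1. [bookkeeping] -/
private theorem isSemialgebraic_pos1 : IsSemialgebraic ℚ {z : Fin 2 → ℝ | 0 < z 1} := by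
  have h := isSemialgebraic_setOf_eval_pos (R := ℝ) (X 1 : MvPolynomial (Fin 2) ℚ)
  have e : {x : Fin 2 → ℝ | 0 < aeval x (X 1 : MvPolynomial (Fin 2) ℚ)} = {z | 0 < z 1} := by
    ext z; simp only [mem_setOf_eq, aeval_X]
  rw [e] at h; exact h

open _root_.Set MvPolynomial in
open Literature.NumberTheory.Transcendental in
open Literature.NumberTheory.Transcendental.KZ (RFun cube) in
open Summit.KontsevichZagierPeriods.RootDecompQuadraticDescent.DarkPairs (rel_reflect_rep rel_double) in
open Literature.ModelTheory.ExponentialFields (IsSemialgebraic isSemialgebraic_setOf_eval_le isSemialgebraic_setOf_eval_pos) in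
/-- Auxiliary step `isSemialgebraic_pos0`: is Semialgebraic pos0. [bookkeeping] -/
private theorem isSemialgebraic_pos0 : IsSemialgebraic ℚ {z : Fin 2 → ℝ | 0 < z 0} := by
  have h := isSemialgebraic_setOf_eval_pos (R := ℝ) (X 0 : MvPolynomial (Fin 2) ℚ)
  have e : {x : Fin 2 → ℝ | 0 < aeval x (X 0 : MvPolynomial (Fin 2) ℚ)} = {z | 0 < z 0} := by
    ext z; simp only [mem_setOf_eq, aeval_X]
  rw [e] at h; exact h

open _root_.Set MvPolynomial in
open Literature.NumberTheory.Transcendental in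
open Literature.NumberTheory.Transcendental.KZ (RFun cube) in
open Summit.KontsevichZagierPeriods.RootDecompQuadraticDescent.DarkPairs (rel_reflect_rep rel_double) in
/-- Auxiliary step `cube2` (§0): cube2. [bookkeeping] -/
private theorem cube2 {x : Fin 2 → ℝ} (hx : x ∈ KZ.cube 2) : (0 ≤ x 0 ∧ x 0 ≤ 1) ∧ (0 ≤ x 1 ∧ x 1 ≤ 1) := ⟨hx 0, hx 1⟩

/-- **THE FIRST PENCIL BRACKET DECIDED**: `4•[Gm] − 4•[Gp] − [B79] ∈ KZ.relations` (`B79 = (π−2θ)²`). -/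
theorem GmGp_B79 : 4 • KZ.of Gm.rep - 4 • KZ.of Gp.rep - KZ.of B79.rep ∈ KZ.relations := by
  have h := KZ.relations.sub_mem (KZ.relations.add_mem (KZ.relations.nsmul_mem Gm_Gp_DG1 4) DG4_B79) DG4_DG1
  convert h using 1
  simp only [smul_sub]
  abel

/-- and against the currency `B17 = (π/2−θ)²`: `4•[Gm] − 4•[Gp] − 4•[B17] ∈ KZ.relations`. -/
theorem GmGp_B17 : 4 • KZ.of Gm.rep - 4 • KZ.of Gp.rep - 4 • KZ.of B17.rep ∈ KZ.relations := by
  have h := KZ.relations.add_mem GmGp_B79 B79_B17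
  convert h using 1
  abel

end Pencil1

section Residual5

/-- **#18 reduced to TWO pencil evaluations against four currencies** (exact): the `[Gm]` bracket is gone —
`4•[Gm] − 4•[Gp] ≡ 4•[B17]` is `GmGp_B17` (§14), so the residual hypothesis now mentions only `[Gp]` and the
`INV`-symmetric combination `2•[Sp] + 2•[Sm] + [M2]`, against the currencies `Th7 = θ²`, `B17 = (π/2−θ)²`,
`Ax0 = π²/24`, `Lbox = log²2` (`Lq`, `MT`, `N7U` are exact multiples of these by §6–§8). -/
theorem pair18_g8strips_of_elem9
    (hElem9 : 6 • KZ.of Gp.rep + 2 • (2 • KZ.of Sp.rep + 2 • KZ.of Sm.rep + KZ.of M2.rep)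
      + 11 • KZ.of Th7.rep - 12 • KZ.of B17.rep - 42 • KZ.of Ax0.rep - KZ.of N7U + 3 • KZ.of Lbox.rep
      - 3 • KZ.of Lq.rep - KZ.of MT ∈ KZ.relations) :
    KZ.of U1.rep - KZ.of U2r.rep + KZ.of SL.rep - 2 • KZ.of K12c.rep + 2 • KZ.of Kh.rep ∈ KZ.relations := by
  refine pair18_g8strips_of_elem8 ?_
  have e : 4 • KZ.of Gm.rep + 2 • KZ.of Gp.rep + 2 • (2 • KZ.of Sp.rep + 2 • KZ.of Sm.rep + KZ.of M2.rep)
      + 11 • KZ.of Th7.rep - 16 • KZ.of B17.rep - 42 • KZ.of Ax0.rep - KZ.of N7U + 3 • KZ.of Lbox.rep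
      - 3 • KZ.of Lq.rep - KZ.of MT =
      (6 • KZ.of Gp.rep + 2 • (2 • KZ.of Sp.rep + 2 • KZ.of Sm.rep + KZ.of M2.rep)
      + 11 • KZ.of Th7.rep - 12 • KZ.of B17.rep - 42 • KZ.of Ax0.rep - KZ.of N7U + 3 • KZ.of Lbox.rep
      - 3 • KZ.of Lq.rep - KZ.of MT)
      + (4 • KZ.of Gm.rep - 4 • KZ.of Gp.rep - 4 • KZ.of B17.rep) := by abel
  rw [e]
  exact add_mem hElem9 GmGp_B17

/-- the same with the (C′) strip conclusion of §3. -/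
theorem pair18_strips_of_elem9
    (hElem9 : 6 • KZ.of Gp.rep + 2 • (2 • KZ.of Sp.rep + 2 • KZ.of Sm.rep + KZ.of M2.rep)
      + 11 • KZ.of Th7.rep - 12 • KZ.of B17.rep - 42 • KZ.of Ax0.rep - KZ.of N7U + 3 • KZ.of Lbox.rep
      - 3 • KZ.of Lq.rep - KZ.of MT ∈ KZ.relations) :
    KZ.of U1.rep - KZ.of U2r.rep + KZ.of SL.rep - 2 • (KZ.of Sp.rep + KZ.of Sm.rep) + 2 • (KZ.of Shp.rep + KZ.of Shm.rep)
      ∈ KZ.relations := by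
  refine pair18_strips_of_elem8 ?_
  have e : 4 • KZ.of Gm.rep + 2 • KZ.of Gp.rep + 2 • (2 • KZ.of Sp.rep + 2 • KZ.of Sm.rep + KZ.of M2.rep)
      + 11 • KZ.of Th7.rep - 16 • KZ.of B17.rep - 42 • KZ.of Ax0.rep - KZ.of N7U + 3 • KZ.of Lbox.rep
      - 3 • KZ.of Lq.rep - KZ.of MT =
      (6 • KZ.of Gp.rep + 2 • (2 • KZ.of Sp.rep + 2 • KZ.of Sm.rep + KZ.of M2.rep)
      + 11 • KZ.of Th7.rep - 12 • KZ.of B17.rep - 42 • KZ.of Ax0.rep - KZ.of N7U + 3 • KZ.of Lbox.rep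
      - 3 • KZ.of Lq.rep - KZ.of MT)
      + (4 • KZ.of Gm.rep - 4 • KZ.of Gp.rep - 4 • KZ.of B17.rep) := by abel
  rw [e]
  exact add_mem hElem9 GmGp_B17

end Residual5

/-! ## §15 (g9) The second pencil bracket: `2•[Gp] ≡ [B17] + 2•[PB7]` (`Gp = ½(π²/4 − θ²)`)

`Gp = [□², ½/GpDen]` is the area of the region `{0<α<α₁, α<φ<π/2}` of the flat angle plane
(`tan α = t/√(8−t²)`, `tan φ = (4x+t(1−x))/((1−x)√(8−t²))`, `α₁ = arctan(1/√7) = π/2 − θ`).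
No RATIONAL change of variables straightens it (the conic `s²+t²=8` has no rational point with
`t ∈ {0,1}`), so we CUT along the conic `7W² = (8−t²)(1−x)²` (`W = 4x+t(1−x)`, i.e. `φ = α₁`):
* the curvilinear triangle `{7W² ≤ (8−t²)(1−x)²}` (`α<φ<α₁`, value `α₁²/2`) goes RATIONALLY onto
  half the arctan box `HB17 = ½·Bbox(1/7)` by `(x,t) ↦ (t(1−x)/W, 7W²/((8−t²)(1−x)²))`
  (Jacobian `448/((8−t²)²(1−x)²)`);
* the rest `{7W² ≥ (8−t²)(1−x)²}` (`φ>α₁`, value `θ·α₁`) goes onto the product box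
  `PB7 = [□², 7/((1+7σ²)(7+ρ²))] = θ·(π/2−θ)` by the ALGEBRAIC map `(x,t) ↦ (t/s, (1−x)s/W)`,
  `s = √((8−t²)/7)` (Jacobian `32/((8−t²)W²)`): the map is semialgebraic (each coordinate is the
  non-negative root of a polynomial equation over the domain) and the integrand identity is
  rational in `s²`.
Hence `2•[Gp] − [B17] − 2•[PB7] ∈ KZ.relations` — the second pencil member is decided against the
currencies `B17 = (π/2−θ)²` and the NEW product currency `PB7 = θ(π/2−θ)`. -/
section Pencil2
open Literature.ModelTheory.ExponentialFields (IsSemialgebraic isSemialgebraic_setOf_eval_le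
  isSemialgebraic_setOf_eval_pos isSemialgebraic_setOf_eval_nonneg isSemialgebraic_setOf_eval_eq_zero)

/-! ### the two currencies -/
/-- Auxiliary definition `PB7Den` (§15): PB7 Den. [bookkeeping] -/
def PB7Den : MvPolynomial (Fin 2) ℚ := (C 1 + C 7 * X 1 * X 1) * (C 7 + X 0 * X 0)
/-- Auxiliary step `PB7Den_pos` (§15): PB7 Den pos. [bookkeeping] -/
theorem PB7Den_pos {x : Fin 2 → ℝ} (hx : x ∈ cube 2) : 0 < aeval x PB7Den := by
  obtain ⟨h0, h1⟩ := cube2 hx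
  have h0' := h0.1
  have h1' := h1.1
  simp only [PB7Den, map_add, map_mul, aeval_C, aeval_X, eq_ratCast, Rat.cast_one, Rat.cast_ofNat]
  positivity
/-- `PB7 = [□², 7/((1+7σ²)(7+ρ²))]` (`ρ = z0`, `σ = z1`) `= arctan √7 · arctan(1/√7) = θ(π/2−θ)`. -/
def PB7 : RFun 2 := ⟨C 7, PB7Den, fun _ hx => (PB7Den_pos hx).ne'⟩

/-- Auxiliary definition `HB17Den` (§15): HB17 Den. [bookkeeping] -/
def HB17Den : MvPolynomial (Fin 2) ℚ := C 2 * (C 7 + X 1) * (C 7 + X 1 * X 0 * X 0)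
/-- Auxiliary step `HB17Den_pos` (§15): HB17 Den pos. [bookkeeping] -/
theorem HB17Den_pos {x : Fin 2 → ℝ} (hx : x ∈ cube 2) : 0 < aeval x HB17Den := by
  obtain ⟨h0, h1⟩ := cube2 hx
  have h0' := h0.1
  have h1' := h1.1
  simp only [HB17Den, map_add, map_mul, aeval_C, aeval_X, eq_ratCast, Rat.cast_one, Rat.cast_ofNat]
  positivity
/-- `HB17 = [□², 7/(2(7+σ)(7+σρ²))]` (`ρ = z0`, `σ = z1`): pointwise one half of `B17 = Bbox(1/7)`. -/
def HB17 : RFun 2 := ⟨C 7, HB17Den, fun _ hx => (HB17Den_pos hx).ne'⟩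

/-- Auxiliary step `B17_HB17` (§15): B17 HB17. [bookkeeping] -/
theorem B17_HB17 : KZ.of B17.rep - 2 • KZ.of HB17.rep ∈ KZ.relations := by
  refine rel_nsmul 2 B17 HB17 fun z hz => ?_
  obtain ⟨h0, h1⟩ := cube2 hz
  have h0' := h0.1
  have h1' := h1.1
  simp only [B17, Bbox, BboxDen, HB17, HB17Den, RFun.fn, map_add, map_sub, map_mul, map_pow, map_neg, aeval_C, aeval_X, map_one, map_ofNat, eq_ratCast, Rat.cast_one, Rat.cast_ofNat, Rat.cast_div, Rat.cast_neg, Nat.cast_ofNat]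
  have ha : (0:ℝ) < 1 + 1 / 7 * z 1 := by positivity
  have hb : (0:ℝ) < 1 + 1 / 7 * z 1 * z 0 * z 0 := by positivity
  field_simp

/-! ### the conic cut of `Gp` -/
/-- Auxiliary definition `WP` (§15): WP. [bookkeeping] -/
def WP : MvPolynomial (Fin 2) ℚ := C 4 * X 0 + X 1 * (C 1 - X 0)
/-- Auxiliary definition `CoL` (§15): Co L. [bookkeeping] -/
def CoL : MvPolynomial (Fin 2) ℚ := C 7 * WP * WP
/-- Auxiliary definition `CoR` (§15): Co R. [bookkeeping] -/
def CoR : MvPolynomial (Fin 2) ℚ := (C 8 - X 1 * X 1) * ((C 1 - X 0) * (C 1 - X 0))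
/-- Auxiliary step `aeval_CoL` (§15): aeval Co L. [bookkeeping] -/
theorem aeval_CoL (z : Fin 2 → ℝ) :
    aeval z CoL = 7 * (4 * z 0 + z 1 * (1 - z 0)) * (4 * z 0 + z 1 * (1 - z 0)) := by
  simp only [CoL, WP, map_mul, map_add, map_sub, aeval_C, aeval_X, eq_ratCast, Rat.cast_ofNat, Rat.cast_one]
/-- Auxiliary step `aeval_CoR` (§15): aeval Co R. [bookkeeping] -/
theorem aeval_CoR (z : Fin 2 → ℝ) : aeval z CoR = (8 - z 1 * z 1) * ((1 - z 0) * (1 - z 0)) := by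
  simp only [CoR, map_mul, map_sub, aeval_C, aeval_X, eq_ratCast, Rat.cast_ofNat, Rat.cast_one]
/-- Auxiliary definition `sP1` (§15): s P1. [bookkeeping] -/
def sP1 : Set (Fin 2 → ℝ) :=
  {z | 7 * (4 * z 0 + z 1 * (1 - z 0)) * (4 * z 0 + z 1 * (1 - z 0)) ≤ (8 - z 1 * z 1) * ((1 - z 0) * (1 - z 0))}
/-- Auxiliary definition `sP2` (§15): s P2. [bookkeeping] -/
def sP2 : Set (Fin 2 → ℝ) :=
  {z | (8 - z 1 * z 1) * ((1 - z 0) * (1 - z 0)) ≤ 7 * (4 * z 0 + z 1 * (1 - z 0)) * (4 * z 0 + z 1 * (1 - z 0))}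
/-- Auxiliary step `isSemialgebraic_sP1` (§15): is Semialgebraic s P1. [bookkeeping] -/
theorem isSemialgebraic_sP1 : IsSemialgebraic ℚ sP1 := by
  have h := isSemialgebraic_setOf_eval_le (R := ℝ) CoL CoR
  have e : {x : Fin 2 → ℝ | aeval x CoL ≤ aeval x CoR} = sP1 := by
    ext z; simp only [mem_setOf_eq, aeval_CoL, aeval_CoR, sP1]
  rw [e] at h; exact h
/-- Auxiliary step `isSemialgebraic_sP2` (§15): is Semialgebraic s P2. [bookkeeping] -/
theorem isSemialgebraic_sP2 : IsSemialgebraic ℚ sP2 := by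
  have h := isSemialgebraic_setOf_eval_le (R := ℝ) CoR CoL
  have e : {x : Fin 2 → ℝ | aeval x CoR ≤ aeval x CoL} = sP2 := by
    ext z; simp only [mem_setOf_eq, aeval_CoL, aeval_CoR, sP2]
  rw [e] at h; exact h
/-- Auxiliary definition `P1` (§15): P1. [bookkeeping] -/
def P1 : Set (Fin 2 → ℝ) := cube 2 ∩ sP1
/-- Auxiliary definition `P2` (§15): P2. [bookkeeping] -/
def P2 : Set (Fin 2 → ℝ) := cube 2 ∩ sP2
/-- Auxiliary definition `P1t` (§15): P1t. [bookkeeping] -/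
def P1t : Set (Fin 2 → ℝ) := cube 2 ∩ sP1 ∩ {z | 0 < z 1}
/-- Auxiliary definition `SqPP` (§15): Sq PP. [bookkeeping] -/
def SqPP : Set (Fin 2 → ℝ) := cube 2 ∩ {z | 0 < z 0} ∩ {z | 0 < z 1}
/-- Auxiliary step `isSemialgebraic_P1` (§15): is Semialgebraic P1. [bookkeeping] -/
theorem isSemialgebraic_P1 : IsSemialgebraic ℚ P1 := KZ.isSemialgebraic_cube.inter isSemialgebraic_sP1
/-- Auxiliary step `isSemialgebraic_P2` (§15): is Semialgebraic P2. [bookkeeping] -/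
theorem isSemialgebraic_P2 : IsSemialgebraic ℚ P2 := KZ.isSemialgebraic_cube.inter isSemialgebraic_sP2
/-- Auxiliary step `isSemialgebraic_P1t` (§15): is Semialgebraic P1t. [bookkeeping] -/
theorem isSemialgebraic_P1t : IsSemialgebraic ℚ P1t :=
  (KZ.isSemialgebraic_cube.inter isSemialgebraic_sP1).inter isSemialgebraic_pos1
/-- Auxiliary step `isSemialgebraic_SqPP` (§15): is Semialgebraic Sq PP. [bookkeeping] -/
theorem isSemialgebraic_SqPP : IsSemialgebraic ℚ SqPP :=
  (KZ.isSemialgebraic_cube.inter isSemialgebraic_pos0).inter isSemialgebraic_pos1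
/-- Auxiliary definition `Gp1` (§15): Gp1. [bookkeeping] -/
def Gp1 : KZ.IntegralRep 2 := Gp.rep.restrict P1 isSemialgebraic_P1 (fun _ hz => hz.1)
/-- Auxiliary definition `Gp2` (§15): Gp2. [bookkeeping] -/
def Gp2 : KZ.IntegralRep 2 := Gp.rep.restrict P2 isSemialgebraic_P2 (fun _ hz => hz.1)
/-- Auxiliary definition `Gp1t` (§15): Gp1t. [bookkeeping] -/
def Gp1t : KZ.IntegralRep 2 := Gp1.restrict P1t isSemialgebraic_P1t (fun _ hz => hz.1)
/-- Auxiliary definition `HBP` (§15): HBP. [bookkeeping] -/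
def HBP : KZ.IntegralRep 2 := HB17.rep.restrict SqPP isSemialgebraic_SqPP (fun _ hz => hz.1.1)

/-- Auxiliary step `volume_conic` (§15): volume conic. [bookkeeping] -/
theorem volume_conic : MeasureTheory.volume {z : Fin 2 → ℝ |
    7 * (4 * z 0 + z 1 * (1 - z 0)) * (4 * z 0 + z 1 * (1 - z 0)) = (8 - z 1 * z 1) * ((1 - z 0) * (1 - z 0))} = 0 := by
  have h := volume_setOf_aeval_eq_zero (k := ℚ) (m := 2) (CoL - CoR) (by
    intro h0
    have h1 := congr_arg (MvPolynomial.eval ![(0:ℝ), 0]) h0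
    simp [CoL, CoR, WP] at h1)
  have e : {x : Fin 2 → ℝ | aeval x (CoL - CoR) = 0} = {z : Fin 2 → ℝ |
      7 * (4 * z 0 + z 1 * (1 - z 0)) * (4 * z 0 + z 1 * (1 - z 0)) = (8 - z 1 * z 1) * ((1 - z 0) * (1 - z 0))} := by
    ext z; simp only [mem_setOf_eq, map_sub, aeval_CoL, aeval_CoR, sub_eq_zero]
  rw [e] at h; exact h

/-- the conic cut: `[Gp] ≡ [Gp | 7W² ≤ (8−t²)(1−x)²] + [Gp | 7W² ≥ (8−t²)(1−x)²]`. -/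
theorem Gp_add : KZ.of Gp.rep - KZ.of Gp1 - KZ.of Gp2 ∈ KZ.relations := by
  refine KZ.domainAddRel_subset_relations ⟨2, Gp.rep, Gp1, Gp2, ?_, ?_, fun _ _ => rfl, fun _ _ => rfl, rfl⟩
  · simp only [Gp1, Gp2, KZ.IntegralRep.domain_restrict, RFun.rep_domain, P1, P2, sP1, sP2]
    ext z
    simp only [mem_union, mem_inter_iff, mem_setOf_eq]
    constructor
    · intro hz
      rcases le_total (7 * (4 * z 0 + z 1 * (1 - z 0)) * (4 * z 0 + z 1 * (1 - z 0)))
          ((8 - z 1 * z 1) * ((1 - z 0) * (1 - z 0))) with h | h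
      · exact Or.inl ⟨hz, h⟩
      · exact Or.inr ⟨hz, h⟩
    · rintro (⟨hz, _⟩ | ⟨hz, _⟩) <;> exact hz
  · refine MeasureTheory.measure_mono_null ?_ volume_conic
    simp only [Gp1, Gp2, KZ.IntegralRep.domain_restrict, P1, P2, sP1, sP2]
    rintro z ⟨⟨_, h1⟩, ⟨_, h2⟩⟩
    simp only [mem_setOf_eq] at h1 h2 ⊢
    exact le_antisymm h1 h2

/-- Auxiliary step `Gp1_t` (§15): Gp1 t. [bookkeeping] -/
theorem Gp1_t : KZ.of Gp1 - KZ.of Gp1t ∈ KZ.relations := by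
  refine rel_restrict_null Gp1 P1t isSemialgebraic_P1t (fun _ hz => hz.1)
    (MeasureTheory.measure_mono_null ?_ volume_edge1)
  intro z hz
  simp only [Gp1, KZ.IntegralRep.domain_restrict] at hz
  obtain ⟨hz, hn⟩ := hz
  simp only [P1t, P1, mem_inter_iff, mem_setOf_eq, not_and, not_lt] at hn hz
  exact le_antisymm (hn hz) (hz.1 1).1

/-- Auxiliary step `HB_P` (§15): HB P. [bookkeeping] -/
theorem HB_P : KZ.of HB17.rep - KZ.of HBP ∈ KZ.relations := by
  refine rel_restrict_null HB17.rep SqPP isSemialgebraic_SqPP (fun _ hz => hz.1.1)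
    (MeasureTheory.measure_mono_null ?_ (MeasureTheory.measure_union_null volume_edge volume_edge1))
  intro z hz
  rw [RFun.rep_domain] at hz
  obtain ⟨hz, hn⟩ := hz
  simp only [SqPP, mem_inter_iff, mem_setOf_eq, not_and, not_lt] at hn
  simp only [mem_union, mem_setOf_eq]
  by_cases h0 : 0 < z 0
  · exact Or.inr (le_antisymm (hn ⟨hz, h0⟩) (hz 1).1)
  · exact Or.inl (le_antisymm (not_lt.1 h0) (hz 0).1)

/-! ### the algebraic function `s(t) = √((8−t²)/7)` -/
/-- Auxiliary definition `sR` (§15): s R. [bookkeeping] -/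
def sR (u : ℝ) : ℝ := Real.sqrt ((8 - u * u) / 7)
/-- Auxiliary step `sR_pos` (§15): s R pos. [bookkeeping] -/
theorem sR_pos {u : ℝ} (hu : u * u < 8) : 0 < sR u := by
  unfold sR
  have : (0:ℝ) < 8 - u * u := by linarith
  exact Real.sqrt_pos.2 (by positivity)
/-- Auxiliary step `sR_sq` (§15): s R sq. [bookkeeping] -/
theorem sR_sq {u : ℝ} (hu : u * u ≤ 8) : sR u ^ 2 = (8 - u * u) / 7 := by
  unfold sR
  have : (0:ℝ) ≤ 8 - u * u := by linarith
  exact Real.sq_sqrt (by positivity)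
/-- Auxiliary step `one_le_sR` (§15): one le s R. [bookkeeping] -/
theorem one_le_sR {u : ℝ} (hu : u * u ≤ 1) : 1 ≤ sR u := by
  unfold sR
  exact (Real.le_sqrt' one_pos).mpr (by nlinarith)
/-- Auxiliary step `hasDerivAt_sR` (§15): has Deriv At s R. [bookkeeping] -/
theorem hasDerivAt_sR {u : ℝ} (hu : u * u < 8) : HasDerivAt sR (-u / (7 * sR u)) u := by
  have hs := sR_pos hu
  have hpos : (0:ℝ) < 8 - u * u := by linarith
  have hne : (8 - u * u) / 7 ≠ 0 := by positivity
  have h := ((((hasDerivAt_id' u).fun_mul (hasDerivAt_id' u)).const_sub 8).div_const 7).sqrt hne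
  refine h.congr_deriv ?_
  have hs' : Real.sqrt ((8 - u * u) / 7) ≠ 0 := by unfold sR at hs; exact hs.ne'
  simp only [sR]
  field_simp
  ring
/-- Auxiliary step `hasDerivAt_rho` (§15): has Deriv At rho. [bookkeeping] -/
theorem hasDerivAt_rho {u : ℝ} (hu : u * u < 8) : HasDerivAt (fun v => v / sR v) (8 / (7 * sR u ^ 3)) u := by
  have hs := sR_pos hu
  have hs2 := sR_sq hu.le
  have h := (hasDerivAt_id' u).fun_div (hasDerivAt_sR hu) hs.ne'
  refine h.congr_deriv ?_
  rw [show (8:ℝ) / (7 * sR u ^ 3) = (7 * sR u ^ 2 + u * u) / (7 * sR u ^ 3) by rw [hs2]; ring]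
  field_simp
  ring

/-- the graph of a non-negative function `f` with `f² · D = N` (`D > 0` polynomials) is semialgebraic. -/
theorem isSemialgebraicFunOn_of_sq {s : Set (Fin 2 → ℝ)} (hs : IsSemialgebraic ℚ s)
    (f : (Fin 2 → ℝ) → ℝ) (N D : MvPolynomial (Fin 2) ℚ) (hD : ∀ x ∈ s, 0 < aeval x D)
    (hf0 : ∀ x ∈ s, 0 ≤ f x) (hf : ∀ x ∈ s, f x ^ 2 * aeval x D = aeval x N) :
    IsSemialgebraicFunOn ℚ s f := by
  rw [isSemialgebraicFunOn_iff]
  have h0 : IsSemialgebraic ℚ {z : Fin 3 → ℝ | 0 ≤ z (Fin.last 2)} := by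
    have h := isSemialgebraic_setOf_eval_nonneg (k := ℚ) (R := ℝ) (X (Fin.last 2) : MvPolynomial (Fin 3) ℚ)
    have e : {x : Fin 3 → ℝ | 0 ≤ aeval x (X (Fin.last 2) : MvPolynomial (Fin 3) ℚ)} =
        {z | 0 ≤ z (Fin.last 2)} := by
      ext z; simp only [mem_setOf_eq, aeval_X]
    rw [e] at h; exact h
  have hq := isSemialgebraic_setOf_eval_eq_zero (k := ℚ) (R := ℝ)
    (X (Fin.last 2) ^ 2 * rename Fin.castSucc D - rename Fin.castSucc N : MvPolynomial (Fin 3) ℚ)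
  convert hs.setOf_init_mem.inter (h0.inter hq) using 1
  have hinit : ∀ z : Fin (2 + 1) → ℝ, (fun i => z (Fin.castSucc i)) = Fin.init z := fun _ => rfl
  ext z
  simp only [mem_setOf_eq, mem_inter_iff, map_sub, map_mul, map_pow, aeval_X, aeval_rename,
    Function.comp_def, hinit, sub_eq_zero]
  constructor
  · rintro ⟨hz, he⟩
    refine ⟨hz, ?_, ?_⟩
    · rw [he]; exact hf0 _ hz
    · rw [he]; exact hf _ hz
  · rintro ⟨hz, hnn, he⟩
    refine ⟨hz, ?_⟩
    have e2 : z (Fin.last 2) ^ 2 = f (Fin.init z) ^ 2 :=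
      mul_right_cancel₀ (hD _ hz).ne' (he.trans (hf _ hz).symm)
    exact (pow_left_inj₀ hnn (hf0 _ hz) two_ne_zero).mp e2

/-- Auxiliary step `P2_facts` (§15): P2 facts. [bookkeeping] -/
theorem P2_facts (z : Fin 2 → ℝ) (hz : z ∈ P2) :
    (0 ≤ z 0 ∧ z 0 ≤ 1) ∧ (0 ≤ z 1 ∧ z 1 ≤ 1) ∧ 0 < 8 - z 1 * z 1 ∧ 0 < 4 * z 0 + z 1 * (1 - z 0) ∧
      0 < sR (z 1) ∧ sR (z 1) ^ 2 = (8 - z 1 * z 1) / 7 ∧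
      (8 - z 1 * z 1) * ((1 - z 0) * (1 - z 0)) ≤ 7 * (4 * z 0 + z 1 * (1 - z 0)) * (4 * z 0 + z 1 * (1 - z 0)) := by
  obtain ⟨hzc, h2⟩ := hz
  obtain ⟨h0, h1⟩ := cube2 hzc
  simp only [sP2, mem_setOf_eq] at h2
  have hΔ : (0:ℝ) < 8 - z 1 * z 1 := by nlinarith
  have hW0 : (0:ℝ) ≤ 4 * z 0 + z 1 * (1 - z 0) := by nlinarith [mul_nonneg h1.1 (sub_nonneg.2 h0.2)]
  have hW : (0:ℝ) < 4 * z 0 + z 1 * (1 - z 0) := by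
    rcases hW0.lt_or_eq with h | h
    · exact h
    · exfalso
      have h2' := h2
      rw [← h] at h2'
      have hA : (1 - z 0) * (1 - z 0) ≤ 0 := by
        nlinarith [mul_nonneg hΔ.le (mul_self_nonneg (1 - z 0))]
      have hA0 : (1 - z 0) * (1 - z 0) = 0 := le_antisymm hA (mul_self_nonneg _)
      have hx : z 0 = 1 := by have := mul_self_eq_zero.mp hA0; linarith
      rw [hx] at h; norm_num at h
  have t8 : z 1 * z 1 < 8 := by nlinarith
  exact ⟨h0, h1, hΔ, hW, sR_pos t8, sR_sq t8.le, h2⟩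

end Pencil2
end Summit.KontsevichZagierPeriods.RootDecompQuadraticDescent.Pair18Homotopy
end
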